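import Summits.HubbardSuperconductivity.HubbardSuperconductivity.Theorems.ParityGapRigidityIncommensurateRigidityEtsBridge
import Literature.MathematicalPhysics.QuantumLattice.FockRelabel
import Literature.MathematicalPhysics.QuantumLattice.SectorSpectrum
import Literature.MathematicalPhysics.QuantumLattice.HubbardLSMFillingProofs
import HarnessLib

/-!
# Route ParityGapRigidity — crux `IncommensurateRigidity` (stmt-HubbardSuperconductivity-2195):
# hypothesis (H2) excludes every range-`≤ 1` density wave in the STRONG (structure-factor) sense

Helper file (`--supports stmt-HubbardSuperconductivity-2195`, line `registered`, lead c9), sequel of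
`ParityGapRigidityIncommensurateRigidityEtsBridge`. (H2) of the crux bounds the VARIANCE
`Re⟨A†A⟩_ψ − |⟨A⟩_ψ|² ≤ C·L²` of every range-`≤ 1` one-body operator `A = Σ_p a(p) c†_{p₁} c_{p₂}`,
`|a| ≤ 1`, in EVERY sector ground state; branch (B) of `EtsTrichotomy` is a SECOND-MOMENT statement
`c·L⁴ ≤ ⟨D_q† D_q⟩_ψ`, and one ground state inside a degenerate multiplet may carry a density wave in the
MEAN with small variance (lead c3's objection to the bridge). Translation invariance of
`hubbardTorus 2 L t U` alone removes the objection, with NO degeneracy bound ((H3) unused): decompose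
`ψ = Σ_k ψ_k` into Fourier components under the translation unitaries `U_v` (`fockTranslate`;
`ψ_k = L⁻² Σ_w conj χ_k(w) U_w ψ`); each `ψ_k` is a sector ground state (or `0`) and a joint
eigenvector of all `U_v`, so `⟨D_q⟩ = 0` on it (`q ≠ 0`) and (H2) gives `‖D_q ψ_k‖² ≤ B‖ψ_k‖²`; the
`D_q ψ_k` carry the pairwise distinct characters `χ_{k-q}`, hence are pairwise orthogonal, and
`‖D_q ψ‖² = Σ_k ‖D_q ψ_k‖² ≤ B`.

* `re_expect_conjTranspose_mul_self_le_of_translation` — abstract form: any `D` with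
  `U_v D = conj χ_q(v) · D U_v`, `q ≠ 0`; variance `≤ B` on all normalised sector ground states ⟹
  second moment `≤ B` on all of them.
* `structureFactor_le_of_normalFluctuationsAt` — (H2) at one side ⟹ `Re⟨O_a† O_a⟩_ψ ≤ C·A²` for every
  coefficient function `a` of nonzero momentum (`a(T_v p) = χ_q(v) a(p)`), `|a| ≤ A`, range `≤ 1`;
  `structureFactor_le_of_normalFluctuations` — packaged over the crux's (H2) verbatim (registered
  sub-goal). The sequel `…EtsBridgeRefined` identifies the density-wave operators of `EtsTrichotomy`
  with such `O_a` and feeds the landed bridge `yangODLRO_of_etsTrichotomy` with (H2) itself.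

No definitions; nothing vendored. Folklore finite-dimensional harmonic analysis of `(ℤ/Lℤ)²` acting by
the tree's `fockTranslate`; sources as in the EtsBridge file.
-/

noncomputable section

namespace Summit.HubbardSuperconductivity.IncommensurateRigidity.Birth

open scoped BigOperators Matrix ComplexConjugate
open Matrix Filter Topology Literature.MathematicalPhysics.QuantumLattice Literature.Probability.LatticeModels

section Abstract

variable {L : ℕ} [NeZero L]

/-- `U_v (U_w ψ) = U_{v+w} ψ`. [folklore] -/
theorem fockTranslate_mulVec_mulVec (v w : TorusSite 2 L) (ψ : Fock (Orb (FermionTorus 2 L))) :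
    (fockTranslate v).val *ᵥ ((fockTranslate w).val *ᵥ ψ) = (fockTranslate (v + w)).val *ᵥ ψ := by
  rw [mulVec_mulVec, fockTranslate_add]; rfl

/-- `⟨U_π u, U_π u'⟩ = ⟨u, u'⟩` for the unitary of any orbital permutation. [folklore] -/
theorem star_fockRelabel_mulVec_dotProduct_two {ι : Type*} [LinearOrder ι] [Fintype ι]
    (π : Equiv.Perm ι) (u u' : Fock ι) :
    star ((fockRelabel π).val *ᵥ u) ⬝ᵥ ((fockRelabel π).val *ᵥ u') = star u ⬝ᵥ u' := by
  rw [star_mulVec, ← dotProduct_mulVec, mulVec_mulVec, ← star_eq_conjTranspose,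
    Matrix.UnitaryGroup.star_mul_self, one_mulVec]

/-- `U_1 = 1` as a matrix. [folklore] -/
theorem fockRelabel_one_val {ι : Type*} [LinearOrder ι] [Fintype ι] :
    (fockRelabel (1 : Equiv.Perm ι)).val = 1 := by
  rw [map_one]; rfl

/-- `⟨U_v u, U_v u'⟩ = ⟨u, u'⟩` for the torus translations. [folklore] -/
theorem star_fockTranslate_mulVec_dotProduct (v : TorusSite 2 L)
    (u u' : Fock (Orb (FermionTorus 2 L))) :
    star ((fockTranslate v).val *ᵥ u) ⬝ᵥ ((fockTranslate v).val *ᵥ u') = star u ⬝ᵥ u' :=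
  star_fockRelabel_mulVec_dotProduct_two (Orb.translate v) u u'

/-- `U_1 u = u`. [folklore] -/
theorem fockRelabel_one_mulVec {ι : Type*} [LinearOrder ι] [Fintype ι] (u : Fock ι) :
    (fockRelabel (1 : Equiv.Perm ι)).val *ᵥ u = u := by rw [fockRelabel_one_val, one_mulVec]

/-- `U_0 u = u` for the torus translations. [folklore] -/
theorem fockTranslate_zero_mulVec (u : Fock (Orb (FermionTorus 2 L))) :
    (fockTranslate (0 : TorusSite 2 L)).val *ᵥ u = u := by
  rw [show fockTranslate (0 : TorusSite 2 L) = fockRelabel (Orb.translate 0) from rfl, Orb.translate_zero]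
  exact fockRelabel_one_mulVec u

/-- `⟨ψ, A†A ψ⟩ = ⟨Aψ, Aψ⟩`. [folklore] -/
theorem expect_conjTranspose_mul_self_eq {ι : Type*} [Fintype ι]
    (A : Matrix (Finset ι) (Finset ι) ℂ) (ψ : Fock ι) :
    expect (Aᴴ * A) ψ = star (A *ᵥ ψ) ⬝ᵥ (A *ᵥ ψ) := by
  rw [expect, ← mulVec_mulVec, dotProduct_mulVec, star_mulVec]

/-- `expect A (c • ψ) = conj c · c · expect A ψ`. [folklore] -/
theorem expect_smul_state {ι : Type*} [Fintype ι] (A : Matrix (Finset ι) (Finset ι) ℂ) (c : ℂ)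
    (ψ : Fock ι) : expect A (c • ψ) = (starRingEnd ℂ) c * c * expect A ψ := by
  rw [expect, expect, mulVec_smul, star_smul, smul_dotProduct, dotProduct_smul, smul_eq_mul,
    smul_eq_mul, Complex.star_def, mul_assoc]

/-- **Character vectors of distinct characters are orthogonal**: if `U_v u = χ_k(v) u` and
`U_v u' = χ_{k'}(v) u'` for all `v`, with `k ≠ k'`, then `⟨u, u'⟩ = 0`. [folklore] -/
theorem dotProduct_eq_zero_of_charVec {k k' : TorusSite 2 L} {u u' : Fock (Orb (FermionTorus 2 L))}
    (hu : ∀ v, (fockTranslate v).val *ᵥ u = torusChar k v • u)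
    (hu' : ∀ v, (fockTranslate v).val *ᵥ u' = torusChar k' v • u') (hkk : k ≠ k') :
    star u ⬝ᵥ u' = 0 := by
  have h : ∀ v, star u ⬝ᵥ u' = torusChar (k' - k) v * (star u ⬝ᵥ u') := by
    intro v
    conv_lhs => rw [← star_fockTranslate_mulVec_dotProduct v u u', hu v, hu' v]
    rw [star_smul, smul_dotProduct, dotProduct_smul, smul_eq_mul, smul_eq_mul, torusChar_sub_left,
      Complex.star_def]
    ring
  have hsum : ∑ _v : TorusSite 2 L, star u ⬝ᵥ u' =
      ∑ v : TorusSite 2 L, torusChar (k' - k) v * (star u ⬝ᵥ u') :=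
    Finset.sum_congr rfl fun v _ => h v
  rw [Finset.sum_const, Finset.card_univ, ← Finset.sum_mul, sum_torusChar_right,
    if_neg (sub_ne_zero.2 (Ne.symm hkk)), zero_mul, nsmul_eq_mul] at hsum
  have hcard : ((Fintype.card (TorusSite 2 L) : ℕ) : ℂ) ≠ 0 := by
    rw [Fintype.card_pi, Finset.prod_const, ZMod.card, Finset.card_univ, Fintype.card_fin]
    exact_mod_cast pow_ne_zero 2 (NeZero.ne L)
  exact (mul_eq_zero.1 hsum).resolve_left hcard

/-- A translation-covariant operator of momentum `q` (`U_v D = conj χ_q(v) · D U_v`) shifts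
characters: `U_v (D u) = χ_{k-q}(v) D u` for a `χ_k`-vector `u`. [folklore] -/
theorem charVec_mulVec_of_covariant {k q : TorusSite 2 L} {u : Fock (Orb (FermionTorus 2 L))}
    {D : Matrix (Finset (Orb (FermionTorus 2 L))) (Finset (Orb (FermionTorus 2 L))) ℂ}
    (hD : ∀ v, (fockTranslate v).val * D =
      (starRingEnd ℂ) (torusChar q v) • (D * (fockTranslate v).val))
    (hu : ∀ v, (fockTranslate v).val *ᵥ u = torusChar k v • u) (v : TorusSite 2 L) :
    (fockTranslate v).val *ᵥ (D *ᵥ u) = torusChar (k - q) v • (D *ᵥ u) := by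
  rw [mulVec_mulVec, hD v, smul_mulVec, ← mulVec_mulVec, hu v, mulVec_smul, smul_smul,
    torusChar_sub_left, mul_comm]

/-- **Pythagoras for a family of pairwise orthogonal vectors indexed by the dual torus.** [folklore] -/
theorem star_sum_dotProduct_sum_of_orthogonal (u : TorusSite 2 L → Fock (Orb (FermionTorus 2 L)))
    (horth : ∀ k k', k ≠ k' → star (u k) ⬝ᵥ u k' = 0) :
    star (∑ k, u k) ⬝ᵥ (∑ k, u k) = ∑ k, star (u k) ⬝ᵥ u k := by
  rw [star_sum, sum_dotProduct]
  refine Finset.sum_congr rfl fun k _ => ?_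
  exact (dotProduct_sum _ _ _).trans (Finset.sum_eq_single k (fun k' _ hk' => horth k k' (Ne.symm hk')) (by simp))

/-- The Fourier component `ψ_k = L⁻² Σ_w conj χ_k(w) U_w ψ` is a `χ_k`-vector:
`U_v ψ_k = χ_k(v) ψ_k`. [folklore] -/
theorem fourierComponent_charVec (ψ : Fock (Orb (FermionTorus 2 L))) (k v : TorusSite 2 L) :
    (fockTranslate v).val *ᵥ
        (((L : ℂ) ^ 2)⁻¹ • ∑ w : TorusSite 2 L,
          (starRingEnd ℂ) (torusChar k w) • ((fockTranslate w).val *ᵥ ψ)) =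
      torusChar k v •
        (((L : ℂ) ^ 2)⁻¹ • ∑ w : TorusSite 2 L,
          (starRingEnd ℂ) (torusChar k w) • ((fockTranslate w).val *ᵥ ψ)) := by
  have key : ∑ w : TorusSite 2 L, (fockTranslate v).val *ᵥ
        ((starRingEnd ℂ) (torusChar k w) • ((fockTranslate w).val *ᵥ ψ)) =
      torusChar k v • ∑ w : TorusSite 2 L,
        (starRingEnd ℂ) (torusChar k w) • ((fockTranslate w).val *ᵥ ψ) := by
    simp_rw [mulVec_smul, fockTranslate_mulVec_mulVec]
    rw [Finset.smul_sum]
    conv_rhs => rw [← Equiv.sum_comp (Equiv.addLeft v)]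
    refine Finset.sum_congr rfl fun w _ => ?_
    simp only [Equiv.coe_addLeft]
    rw [smul_smul, torusChar_add_right, map_mul, ← mul_assoc, torusChar_mul_conj, one_mul]
  rw [mulVec_smul, mulVec_sum, key, smul_comm]

/-- **Fourier inversion**: `Σ_k ψ_k = ψ`. [folklore] -/
theorem sum_fourierComponent (ψ : Fock (Orb (FermionTorus 2 L))) :
    ∑ k : TorusSite 2 L, (((L : ℂ) ^ 2)⁻¹ • ∑ w : TorusSite 2 L,
        (starRingEnd ℂ) (torusChar k w) • ((fockTranslate w).val *ᵥ ψ)) = ψ := by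
  rw [← Finset.smul_sum, Finset.sum_comm]
  have h : ∀ w : TorusSite 2 L, ∑ k : TorusSite 2 L,
      (starRingEnd ℂ) (torusChar k w) • ((fockTranslate w).val *ᵥ ψ) =
        (if w = 0 then (L : ℂ) ^ 2 else 0) • ((fockTranslate w).val *ᵥ ψ) := by
    intro w
    rw [← Finset.sum_smul, ← map_sum, sum_torusChar_left]
    congr 1
    split_ifs <;> simp
  simp_rw [h, ite_smul, zero_smul, Finset.sum_ite_eq', Finset.mem_univ, if_true]
  rw [fockTranslate_zero_mulVec, smul_smul, inv_mul_cancel₀ natCast_pow_ne_zero, one_smul]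

/-- **The Fourier components of a sector ground state of the (translation-invariant) Hubbard torus
stay in the sector ground space**: `ψ_k ∈ szSector N M` and `H ψ_k = E₀ ψ_k`. [folklore] -/
theorem fourierComponent_mem (t U : ℝ) {N : ℕ} {M : ℝ} {ψ : Fock (Orb (FermionTorus 2 L))}
    (hψ : IsGroundStateInSector (hubbardTorus 2 L t U) N M ψ) (k : TorusSite 2 L) :
    (((L : ℂ) ^ 2)⁻¹ • ∑ w : TorusSite 2 L,
        (starRingEnd ℂ) (torusChar k w) • ((fockTranslate w).val *ᵥ ψ)) ∈ szSector N M ∧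
      hubbardTorus 2 L t U *ᵥ (((L : ℂ) ^ 2)⁻¹ • ∑ w : TorusSite 2 L,
          (starRingEnd ℂ) (torusChar k w) • ((fockTranslate w).val *ᵥ ψ)) =
        (((hubbardTorus 2 L t U).minEnergyOn (szSector N M) : ℝ) : ℂ) •
          (((L : ℂ) ^ 2)⁻¹ • ∑ w : TorusSite 2 L,
            (starRingEnd ℂ) (torusChar k w) • ((fockTranslate w).val *ᵥ ψ)) := by
  obtain ⟨hmem, -, heig⟩ := hψ
  refine ⟨Submodule.smul_mem _ _ (Submodule.sum_mem _ fun w _ =>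
    Submodule.smul_mem _ _ (fockTranslate_mulVec_mem_szSector w hmem)), ?_⟩
  rw [mulVec_smul, mulVec_sum, smul_comm]
  congr 1
  rw [Finset.smul_sum]
  refine Finset.sum_congr rfl fun w _ => ?_
  rw [mulVec_smul, mulVec_mulVec, ← (fockTranslate_commute_hubbardTorus w t U).eq, ← mulVec_mulVec,
    heig, mulVec_smul, smul_comm]

/-- **Variance bound over all sector ground states ⟹ second-moment bound over all sector ground
states, for translation-covariant operators of nonzero momentum.** Let `D` satisfy
`U_v D = conj χ_q(v) · D U_v` for all translations `v`, with `q ≠ 0`, and suppose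
`Re⟨φ, D†D φ⟩ − |⟨φ, D φ⟩|² ≤ B` for every normalised `(N, S^z = M)`-sector ground state `φ` of the
Hubbard torus `hubbardTorus 2 L t U`. Then `Re⟨ψ, D†D ψ⟩ ≤ B` for every normalised sector ground
state `ψ`. (Fourier decomposition over the translation group: the components are sector ground states
and joint translation eigenvectors, on which `⟨D⟩ = 0`; the `D ψ_k` are pairwise orthogonal.)
No bound on the ground-state degeneracy is needed. [folklore] -/
theorem re_expect_conjTranspose_mul_self_le_of_translation (t U : ℝ) (N : ℕ) (M : ℝ)
    (D : Matrix (Finset (Orb (FermionTorus 2 L))) (Finset (Orb (FermionTorus 2 L))) ℂ)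
    {q : TorusSite 2 L} (hq : q ≠ 0)
    (hD : ∀ v, (fockTranslate v).val * D =
      (starRingEnd ℂ) (torusChar q v) • (D * (fockTranslate v).val))
    {B : ℝ}
    (hvar : ∀ φ, IsGroundStateInSector (hubbardTorus 2 L t U) N M φ → star φ ⬝ᵥ φ = 1 →
      (expect (Dᴴ * D) φ).re - ‖expect D φ‖ ^ 2 ≤ B)
    (ψ : Fock (Orb (FermionTorus 2 L))) (hψ : IsGroundStateInSector (hubbardTorus 2 L t U) N M ψ)
    (hn : star ψ ⬝ᵥ ψ = 1) :
    (expect (Dᴴ * D) ψ).re ≤ B := by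
  set P : TorusSite 2 L → Fock (Orb (FermionTorus 2 L)) := fun k =>
    ((L : ℂ) ^ 2)⁻¹ • ∑ w : TorusSite 2 L,
      (starRingEnd ℂ) (torusChar k w) • ((fockTranslate w).val *ᵥ ψ) with hP
  have hchar : ∀ k v, (fockTranslate v).val *ᵥ P k = torusChar k v • P k := fun k v =>
    fourierComponent_charVec ψ k v
  have hsum : ∑ k, P k = ψ := sum_fourierComponent ψ
  have hmem : ∀ k, P k ∈ szSector N M ∧ hubbardTorus 2 L t U *ᵥ P k =
      (((hubbardTorus 2 L t U).minEnergyOn (szSector N M) : ℝ) : ℂ) • P k := fun k =>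
    fourierComponent_mem t U hψ k
  have hDk : ∀ k v, (fockTranslate v).val *ᵥ (D *ᵥ P k) = torusChar (k - q) v • (D *ᵥ P k) :=
    fun k v => charVec_mulVec_of_covariant hD (hchar k) v
  have horthP : ∀ k k', k ≠ k' → star (P k) ⬝ᵥ P k' = 0 := fun k k' h =>
    dotProduct_eq_zero_of_charVec (hchar k) (hchar k') h
  have horthD : ∀ k k', k ≠ k' → star (D *ᵥ P k) ⬝ᵥ (D *ᵥ P k') = 0 := fun k k' h =>
    dotProduct_eq_zero_of_charVec (hDk k) (hDk k') fun h' => h (sub_left_inj.1 h')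
  -- per component: `‖D ψ_k‖² ≤ B ‖ψ_k‖²`
  have hcomp : ∀ k, (star (D *ᵥ P k) ⬝ᵥ (D *ᵥ P k)).re ≤ B * (star (P k) ⬝ᵥ P k).re := by
    intro k
    by_cases hk : P k = 0
    · simp [hk]
    · obtain ⟨c, hc, hc1⟩ := exists_smul_unit hk
      have hgs : IsGroundStateInSector (hubbardTorus 2 L t U) N M (c • P k) :=
        ⟨Submodule.smul_mem _ _ (hmem k).1, smul_ne_zero hc hk, by
          rw [mulVec_smul, (hmem k).2, smul_comm]⟩
      have h1 : ∀ v, (fockTranslate v).val *ᵥ (c • P k) = torusChar k v • (c • P k) := fun v => by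
        rw [mulVec_smul, hchar, smul_comm]
      have hmean : expect D (c • P k) = 0 :=
        dotProduct_eq_zero_of_charVec h1 (charVec_mulVec_of_covariant hD h1)
          fun h => hq (sub_eq_self.1 h.symm)
      have hv := hvar (c • P k) hgs hc1
      rw [hmean, norm_zero, zero_pow two_ne_zero, sub_zero, expect_smul_state,
        expect_conjTranspose_mul_self_eq, Complex.conj_mul', ← Complex.ofReal_pow,
        Complex.re_ofReal_mul] at hv
      -- normalisation: `‖c‖² ⟨P k, P k⟩ = 1`
      have hnorm : ‖c‖ ^ 2 * (star (P k) ⬝ᵥ P k).re = 1 := by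
        have h := congrArg Complex.re hc1
        rwa [star_smul, smul_dotProduct, dotProduct_smul, smul_eq_mul, smul_eq_mul, ← mul_assoc,
          Complex.star_def, Complex.conj_mul', ← Complex.ofReal_pow, Complex.re_ofReal_mul,
          Complex.one_re] at h
      have hr : 0 ≤ (star (P k) ⬝ᵥ P k).re := (star_dotProduct_self_re_pos hk).le
      calc (star (D *ᵥ P k) ⬝ᵥ (D *ᵥ P k)).re
          = (‖c‖ ^ 2 * (star (P k) ⬝ᵥ P k).re) * (star (D *ᵥ P k) ⬝ᵥ (D *ᵥ P k)).re := by
            rw [hnorm, one_mul]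
        _ = (star (P k) ⬝ᵥ P k).re * (‖c‖ ^ 2 * (star (D *ᵥ P k) ⬝ᵥ (D *ᵥ P k)).re) := by ring
        _ ≤ (star (P k) ⬝ᵥ P k).re * B := mul_le_mul_of_nonneg_left hv hr
        _ = B * (star (P k) ⬝ᵥ P k).re := mul_comm _ _
  -- assemble: `⟨Dψ, Dψ⟩ = Σ_k ⟨Dψ_k, Dψ_k⟩ ≤ B Σ_k ⟨ψ_k, ψ_k⟩ = B ⟨ψ, ψ⟩ = B`
  have hDsum : D *ᵥ ψ = ∑ k, D *ᵥ P k := by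
    conv_lhs => rw [← hsum]
    rw [mulVec_sum]
  have hnormsum : ∑ k, (star (P k) ⬝ᵥ P k).re = 1 := by
    rw [← Complex.re_sum, ← star_sum_dotProduct_sum_of_orthogonal P horthP, hsum, hn, Complex.one_re]
  rw [expect_conjTranspose_mul_self_eq, hDsum,
    star_sum_dotProduct_sum_of_orthogonal (fun k => D *ᵥ P k) horthD, Complex.re_sum]
  calc ∑ k, (star (D *ᵥ P k) ⬝ᵥ (D *ᵥ P k)).re ≤ ∑ k, B * (star (P k) ⬝ᵥ P k).re :=
        Finset.sum_le_sum fun k _ => hcomp k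
    _ = B := by rw [← Finset.mul_sum, hnormsum, mul_one]

/-- **Translating a one-body operator translates its coefficient function**:
`U_v (Σ_p a(p) c†_{p₁} c_{p₂}) U_vᴴ = Σ_p a(T_{-v} p) c†_{p₁} c_{p₂}`. [folklore] -/
theorem relabel_translate_oneBody (v : TorusSite 2 L)
    (a : Orb (FermionTorus 2 L) × Orb (FermionTorus 2 L) → ℂ) :
    relabel (Orb.translate v) (∑ p, a p • (creation p.1 * annihilation p.2)) =
      ∑ p : Orb (FermionTorus 2 L) × Orb (FermionTorus 2 L),
        a (Orb.translate (-v) p.1, Orb.translate (-v) p.2) • (creation p.1 * annihilation p.2) := by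
  rw [relabel_sum]
  simp_rw [relabel_smul, relabel_mul, relabel_creation, relabel_annihilation]
  conv_lhs => rw [← Equiv.sum_comp ((Orb.translate (-v)).prodCongr (Orb.translate (-v)))]
  refine Finset.sum_congr rfl fun p _ => ?_
  obtain ⟨p₁, p₂⟩ := p
  simp [Orb.translate_neg]

/-- **A one-body operator whose coefficient function has momentum `q`** (`a(T_v p) = χ_q(v) a(p)`)
is translation covariant: `U_v O_a = conj χ_q(v) · O_a U_v`. [folklore] -/
theorem fockTranslate_mul_oneBody_of_covariant
    (a : Orb (FermionTorus 2 L) × Orb (FermionTorus 2 L) → ℂ) (q : TorusSite 2 L)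
    (hcov : ∀ (v : TorusSite 2 L) (p : Orb (FermionTorus 2 L) × Orb (FermionTorus 2 L)),
      a (Orb.translate v p.1, Orb.translate v p.2) = torusChar q v * a p)
    (v : TorusSite 2 L) :
    (fockTranslate v).val * (∑ p, a p • (creation p.1 * annihilation p.2)) =
      (starRingEnd ℂ) (torusChar q v) •
        ((∑ p, a p • (creation p.1 * annihilation p.2)) * (fockTranslate v).val) := by
  have h : relabel (Orb.translate v) (∑ p, a p • (creation p.1 * annihilation p.2)) =
      (starRingEnd ℂ) (torusChar q v) •
        ∑ p : Orb (FermionTorus 2 L) × Orb (FermionTorus 2 L), a p • (creation p.1 * annihilation p.2) := by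
    rw [relabel_translate_oneBody, Finset.smul_sum]
    refine Finset.sum_congr rfl fun p _ => ?_
    rw [hcov (-v) p, torusChar_neg_right, smul_smul]
  have h' := (relabel_eq_fockRelabel_conj (Orb.translate v) _).symm.trans h
  have h2 := fockRelabel_mul_eq_of_conj_eq (Orb.translate v) h'
  rw [smul_mul_assoc] at h2
  exact h2

/-- **(H2) ⟹ range-`≤ 1` structure factors, coefficient form.** If every normalised
`(N, S^z = M)`-sector ground state `φ` of `hubbardTorus 2 L t U` obeys the variance bound
`Re⟨O_b† O_b⟩_φ − |⟨O_b⟩_φ|² ≤ C` for every one-body operator `O_b = Σ_p b(p) c†_{p₁} c_{p₂}` with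
`|b| ≤ 1` supported on pairs at torus distance `≤ 1` (the crux's (H2) at one side), then for every
coefficient function `a` with `|a| ≤ A`, the same support, and a NONZERO momentum `q`
(`a(T_v p) = χ_q(v) a(p)`), the SECOND MOMENT obeys `Re⟨O_a† O_a⟩_ψ ≤ C·A²` in every normalised
sector ground state `ψ` (apply the abstract bound to `b = a/A`). [folklore] -/
theorem structureFactor_le_of_normalFluctuationsAt (t U : ℝ) (N : ℕ) (M : ℝ) {C : ℝ}
    (hH2 : ∀ φ, IsGroundStateInSector (hubbardTorus 2 L t U) N M φ → star φ ⬝ᵥ φ = 1 →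
      ∀ b : Orb (FermionTorus 2 L) × Orb (FermionTorus 2 L) → ℂ, (∀ p, ‖b p‖ ≤ 1) →
        (∀ p, b p ≠ 0 → torusDist (ofLex p.1).1.toTorusSite (ofLex p.2).1.toTorusSite ≤ 1) →
        (expect (Matrix.conjTranspose (∑ p, b p • (creation p.1 * annihilation p.2)) *
            (∑ p, b p • (creation p.1 * annihilation p.2))) φ).re -
          ‖expect (∑ p, b p • (creation p.1 * annihilation p.2)) φ‖ ^ 2 ≤ C)
    (a : Orb (FermionTorus 2 L) × Orb (FermionTorus 2 L) → ℂ) {A : ℝ} (hA : 0 < A)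
    (ha : ∀ p, ‖a p‖ ≤ A)
    (hsupp : ∀ p, a p ≠ 0 → torusDist (ofLex p.1).1.toTorusSite (ofLex p.2).1.toTorusSite ≤ 1)
    {q : TorusSite 2 L} (hq : q ≠ 0)
    (hcov : ∀ (v : TorusSite 2 L) (p : Orb (FermionTorus 2 L) × Orb (FermionTorus 2 L)),
      a (Orb.translate v p.1, Orb.translate v p.2) = torusChar q v * a p)
    (ψ : Fock (Orb (FermionTorus 2 L))) (hψ : IsGroundStateInSector (hubbardTorus 2 L t U) N M ψ)
    (hn : star ψ ⬝ᵥ ψ = 1) :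
    (expect (Matrix.conjTranspose (∑ p, a p • (creation p.1 * annihilation p.2)) *
        (∑ p, a p • (creation p.1 * annihilation p.2))) ψ).re ≤ C * A ^ 2 := by
  -- the rescaled coefficient `b = a / A`
  set c : ℂ := ((A⁻¹ : ℝ) : ℂ) with hc
  set b : Orb (FermionTorus 2 L) × Orb (FermionTorus 2 L) → ℂ := fun p => c * a p with hb
  have hb1 : ∀ p, ‖b p‖ ≤ 1 := fun p => by
    simp only [hb, hc, norm_mul, Complex.norm_real, Real.norm_eq_abs, abs_of_pos (inv_pos.2 hA)]
    calc A⁻¹ * ‖a p‖ ≤ A⁻¹ * A := by gcongr; exact ha p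
      _ = 1 := inv_mul_cancel₀ hA.ne'
  have hc0 : c ≠ 0 := by
    rw [hc, Ne, Complex.ofReal_eq_zero]
    exact (inv_pos.2 hA).ne'
  have hbsupp : ∀ p, b p ≠ 0 →
      torusDist (ofLex p.1).1.toTorusSite (ofLex p.2).1.toTorusSite ≤ 1 := fun p hp =>
    hsupp p fun h => hp (by simp only [hb, h, mul_zero])
  have hbcov : ∀ (v : TorusSite 2 L) (p : Orb (FermionTorus 2 L) × Orb (FermionTorus 2 L)),
      b (Orb.translate v p.1, Orb.translate v p.2) = torusChar q v * b p := fun v p => by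
    simp only [hb]
    rw [hcov]
    ring
  have hO : (∑ p, b p • (creation p.1 * annihilation p.2)) =
      c • ∑ p : Orb (FermionTorus 2 L) × Orb (FermionTorus 2 L), a p • (creation p.1 * annihilation p.2) := by
    rw [Finset.smul_sum]
    simp_rw [hb, mul_smul]
  have hmain := re_expect_conjTranspose_mul_self_le_of_translation t U N M _ hq
    (fockTranslate_mul_oneBody_of_covariant b q hbcov) (fun φ hφ hφn => hH2 φ hφ hφn b hb1 hbsupp) ψ hψ hn
  rw [hO, conjTranspose_smul, smul_mul_assoc, mul_smul_comm, smul_smul, expect_smul] at hmain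
  have hcc : star c * c = (((A⁻¹) ^ 2 : ℝ) : ℂ) := by
    rw [hc, Complex.star_def, Complex.conj_ofReal]
    push_cast
    ring
  rw [hcc, Complex.re_ofReal_mul] at hmain
  -- `A⁻² X ≤ C` ⟹ `X ≤ C A²`
  have hA2 : 0 < A ^ 2 := by positivity
  calc (expect (Matrix.conjTranspose (∑ p, a p • (creation p.1 * annihilation p.2)) *
          (∑ p, a p • (creation p.1 * annihilation p.2))) ψ).re
      = A ^ 2 * (A⁻¹ ^ 2 * (expect (Matrix.conjTranspose (∑ p, a p • (creation p.1 * annihilation p.2)) *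
          (∑ p, a p • (creation p.1 * annihilation p.2))) ψ).re) := by
        rw [← mul_assoc, ← mul_pow, mul_inv_cancel₀ hA.ne', one_pow, one_mul]
    _ ≤ A ^ 2 * C := mul_le_mul_of_nonneg_left hmain hA2.le
    _ = C * A ^ 2 := mul_comm _ _

/-- **(H2) of the crux ⟹ bounded range-`≤ 1` structure factors, packaged over (H2) verbatim.**
With the constant `C` and threshold `L₀` of (H2) at `(U, δ)`: for every even `L ≥ L₀`, every
normalised `(N_L, 0)`-sector ground state `ψ` of `hubbardTorus 2 L 1 U`, every coefficient function `a`
with `|a| ≤ A`, range `≤ 1` and nonzero momentum `q`, `Re⟨O_a† O_a⟩_ψ ≤ C·L²·A²`. [folklore] -/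
theorem structureFactor_le_of_normalFluctuations :
    ∀ (U δ : ℝ), (∃ C : ℝ, ∃ L₀ : ℕ, ∀ L ≥ L₀, Even L → ∀ Hm, Hm = hubbardTorus 2 L 1 U → ∀ ψ,
      IsGroundStateInSector Hm (2 * ⌊(1 - δ) * (L : ℝ) ^ 2 / 2⌋₊) 0 ψ → star ψ ⬝ᵥ ψ = 1 →
      ∀ a : Orb (FermionTorus 2 L) × Orb (FermionTorus 2 L) → ℂ, (∀ p, ‖a p‖ ≤ 1) →
        (∀ p, a p ≠ 0 → torusDist (ofLex p.1).1.toTorusSite (ofLex p.2).1.toTorusSite ≤ 1) →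
        (expect (Matrix.conjTranspose (∑ p, a p • (creation p.1 * annihilation p.2)) *
            (∑ p, a p • (creation p.1 * annihilation p.2))) ψ).re -
          ‖expect (∑ p, a p • (creation p.1 * annihilation p.2)) ψ‖ ^ 2 ≤ C * (L : ℝ) ^ 2) →
      ∃ C : ℝ, ∃ L₀ : ℕ, ∀ (L : ℕ) [NeZero L], L₀ ≤ L → Even L → ∀ ψ,
        IsGroundStateInSector (hubbardTorus 2 L 1 U) (2 * ⌊(1 - δ) * (L : ℝ) ^ 2 / 2⌋₊) 0 ψ →
        star ψ ⬝ᵥ ψ = 1 →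
        ∀ (a : Orb (FermionTorus 2 L) × Orb (FermionTorus 2 L) → ℂ) (A : ℝ), 0 < A →
          (∀ p, ‖a p‖ ≤ A) →
          (∀ p, a p ≠ 0 → torusDist (ofLex p.1).1.toTorusSite (ofLex p.2).1.toTorusSite ≤ 1) →
          ∀ q : TorusSite 2 L, q ≠ 0 →
            (∀ (v : TorusSite 2 L) (p : Orb (FermionTorus 2 L) × Orb (FermionTorus 2 L)),
              a (Orb.translate v p.1, Orb.translate v p.2) = torusChar q v * a p) →
            (expect (Matrix.conjTranspose (∑ p, a p • (creation p.1 * annihilation p.2)) *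
                (∑ p, a p • (creation p.1 * annihilation p.2))) ψ).re ≤ C * (L : ℝ) ^ 2 * A ^ 2 := by
  rintro U δ ⟨C, L₀, h⟩
  exact ⟨C, L₀, fun L _ hL hE ψ hgs hn a A hA ha hs q hq hcov =>
    structureFactor_le_of_normalFluctuationsAt 1 U _ 0
      (fun φ hφ hφn b hb1 hbs => h L hL hE _ rfl φ hφ hφn b hb1 hbs) a hA ha hs hq hcov ψ hgs hn⟩

end Abstract

end Summit.HubbardSuperconductivity.IncommensurateRigidity.Birth

end
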